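import Summits.ABC.ABC.Theorems.DefiniteXiFreyModularityGlueNotThreeDvd
import Summits.ABC.ABC.Theorems.DefiniteXiFreyModularityGlueTwist
import Summits.ABC.ABC.Theorems.DefiniteXiFreyModularityGlueKubert
import Literature.NumberTheory.EllipticCurves.SwanConductorTorsionProofs
import Literature.NumberTheory.DiophantineGeometry.FreyCurveConductorTwoTwistDichotomyProofs
import HarnessLib

/-!
# Crux `FreyModularity` (stmt-ABC-11340), line `Sketch`, reshape 3: the glue stub
# `stub_freyFiveIrreducibleGlue` — Frey rigidity at `5` from Serre's dichotomy, the Swan parity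
# and Kubert 1976

Registered stub `stub_freyFiveIrreducibleGlue` of the skeleton
`Summits/ABC/ABC/Cruxes/FreyModularity/Lines/Sketch.lean` (lead prover, reshape 3).  Granted, as
hypotheses, the three statements of the sibling stubs

* S5 `stub_freySemistableDichotomy` — for a normalised Frey curve `E_(A,B)` (`A ≡ −1 (mod 4)`) with
  `16 ∣ B`, a `Γ_ℚ`-stable subgroup `H` of `E[5]`, `H ≠ 0, E[5]`, is fixed pointwise or has trivial
  quotient action (Serre 1972 Prop. 21 ii); LANDED, p117468);
* S6 `stub_freySwanOdd` — for a normalised Frey curve with `2 ∣ B`, `16 ∤ B`, `2A + B ≠ 0` there is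
  a prime `𝔓 ∣ 2` of `\bar ℤ` with `Sw_𝔓(E[5]) ∈ {1, 3}` (Diamond–Kramer 1995, Lemma 2);
* S7 `stub_swanEvenOfStableLine` — a `Γ_ℚ`-stable line in `E[5]` forces `Sw_𝔓(E[5]) = 2n` at every
  `𝔓 ∣ 2` (Diamond–Kramer 1995, Lemma 3),

this file proves that **`E[5]` has no `Γ_ℚ`-stable subgroup other than `0` and `E[5]` for every Frey
curve `E_(a,b) : y² = x(x − a)(x + b)`, `a, b` coprime, `ab(a+b) ≠ 0`**:

1. *Normalisation* (Rubin–Silverberg / Diamond–Kramer Lemma 1; `exists_normalised_freyCurve`):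
   `E_(a,b) ≅ E_(−a,a+b)` (translation by a `2`-torsion point, `translate_freyCurve`),
   `E_(b,a) = E_(−a,−b)` (`freyCurve_swap`) and `E_(a,b)^{(−1)} = E_(b,a)`
   (`quadraticTwist_freyCurve_neg_one`) preserve (ir)reducibility of `E[5]`
   (`Mazur1978.hasIrreducibleModPGaloisRep_smul_iff`, `stub_glue_twist`), and exactly one of
   `a, b, a+b` is even, so one reaches `A ≡ −1 (mod 4)`, `2 ∣ B`.
2. *`16 ∣ B`*: S5 and `stub_glue_dichotomy` (Kubert 1976 via `X₁(2,10)`, both branches).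
3. *`16 ∤ B`, `2A + B ≠ 0`*: S6 and S7 give `2n ∈ {1, 3}` in `ℝ`, absurd.
4. *`2A + B = 0`*: coprimality forces `A = ±1`, the curve is `y² = x³ − x` up to sign, `3 ∤ 2A³`,
   and `stub_glue_notThreeDvd` (`a₃ = 0`, Mazur Prop. 6.3 (1)) applies.
-/

-- `Summit.<Summit>.<Problem>` is the mandated summit-side namespace (CONVENTIONS §2); for the
-- single-conjunct summit `ABC` the two coincide, so the duplicate `ABC.ABC` is deliberate.
set_option linter.dupNamespace false

noncomputable section

open scoped NumberField

open Literature.NumberTheory.EllipticCurves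
open Literature.NumberTheory.GaloisRepresentations
open Literature.NumberTheory.DiophantineGeometry
open WeierstrassCurve IsDedekindDomain Field

namespace Summit.ABC.ABC.Theorems

-- `E[n]` as an `𝔽_n`-module (needed to speak of `W.torsionGaloisRep n`, as in the tree's Swan files).
attribute [local instance] AddSubgroup.torsionBy.zmodModule

/-! ### The six presentations and the `−1` twist preserve (ir)reducibility of `E[p]` -/

/-- `E_(−A, A+B) ≅ E_(A,B)` (translation by the `2`-torsion point `(A, 0)`), so the two have
irreducible `ρ̄_p` together. [cite: SilvermanAEC2009, III.1 Table 3.1] -/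
theorem hasIrreducibleModPGaloisRep_freyCurve_translate_iff (A B : ℤ) (p : ℕ) :
    (freyCurve (-A) (A + B)).HasIrreducibleModPGaloisRep p ↔
      (freyCurve A B).HasIrreducibleModPGaloisRep p := by
  rw [← translate_freyCurve A B]
  exact Mazur1978.hasIrreducibleModPGaloisRep_smul_iff (freyCurve A B) _ p

/-- `E_(B,A) = E_(A,B)^{(−1)}` (the quadratic twist by `−1`), so the two have irreducible `ρ̄_p`
together (`stub_glue_twist`). [cite: SilvermanAEC2009, X.5 Cor. 5.4] -/
theorem hasIrreducibleModPGaloisRep_freyCurve_swap_iff (A B : ℤ) (p : ℕ) :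
    (freyCurve B A).HasIrreducibleModPGaloisRep p ↔ (freyCurve A B).HasIrreducibleModPGaloisRep p := by
  rw [← quadraticTwist_freyCurve_neg_one A B]
  exact stub_glue_twist (freyCurve A B) (-1) (by norm_num) p

/-- `E_(−A,−B) = E_(B,A)`, so `E_(−A,−B)` and `E_(A,B)` have irreducible `ρ̄_p` together.
[cite: SilvermanAEC2009, X.5 Cor. 5.4] -/
theorem hasIrreducibleModPGaloisRep_freyCurve_neg_iff (A B : ℤ) (p : ℕ) :
    (freyCurve (-A) (-B)).HasIrreducibleModPGaloisRep p ↔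
      (freyCurve A B).HasIrreducibleModPGaloisRep p := by
  rw [← freyCurve_swap A B]
  exact hasIrreducibleModPGaloisRep_freyCurve_swap_iff A B p

/-! ### Normalisation `A ≡ −1 (mod 4)`, `2 ∣ B` -/

/-- Sign fix: if `A` is odd, either `(A, B)` or `(−A, −B)` has first entry `≡ −1 (mod 4)`; both
presentations have the same curve up to the `−1` twist. [cite: DiamondKramer1995, Lemma 1] -/
theorem exists_normalised_freyCurve_of_odd {A B : ℤ} (hAB : IsCoprime A B) (h0 : A * B * (A + B) ≠ 0)
    (hA : ¬ (2 : ℤ) ∣ A) (hB : (2 : ℤ) ∣ B) (p : ℕ) :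
    ∃ A' B' : ℤ, IsCoprime A' B' ∧ A' * B' * (A' + B') ≠ 0 ∧ A' ≡ -1 [ZMOD 4] ∧ (2 : ℤ) ∣ B' ∧
      ((freyCurve A B).HasIrreducibleModPGaloisRep p ↔
        (freyCurve A' B').HasIrreducibleModPGaloisRep p) := by
  by_cases h4 : A ≡ -1 [ZMOD 4]
  · exact ⟨A, B, hAB, h0, h4, hB, Iff.rfl⟩
  · refine ⟨-A, -B, hAB.neg_neg, ?_, ?_, (dvd_neg).mpr hB,
      (hasIrreducibleModPGaloisRep_freyCurve_neg_iff A B p).symm⟩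
    · have : (-A) * (-B) * (-A + -B) = -(A * B * (A + B)) := by ring
      rw [this]; exact neg_ne_zero.mpr h0
    · unfold Int.ModEq at h4 ⊢
      omega

/-- **Normalisation of a Frey curve** (Rubin–Silverberg; Diamond–Kramer 1995, Lemma 1): for coprime
`a, b` with `ab(a+b) ≠ 0` there are coprime `A, B` with `AB(A+B) ≠ 0`, `A ≡ −1 (mod 4)`, `2 ∣ B`
such that `E_(a,b)[p]` is irreducible iff `E_(A,B)[p]` is (exactly one of `a, b, a + b` is even;
move it to the `B`-slot by a translation / the `−1` twist, then fix the sign of `A`).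
[cite: DiamondKramer1995, Lemma 1] -/
theorem exists_normalised_freyCurve {a b : ℤ} (hab : IsCoprime a b) (h0 : a * b * (a + b) ≠ 0)
    (p : ℕ) :
    ∃ A B : ℤ, IsCoprime A B ∧ A * B * (A + B) ≠ 0 ∧ A ≡ -1 [ZMOD 4] ∧ (2 : ℤ) ∣ B ∧
      ((freyCurve a b).HasIrreducibleModPGaloisRep p ↔
        (freyCurve A B).HasIrreducibleModPGaloisRep p) := by
  have hnot := not_two_dvd_and_two_dvd_of_isCoprime hab
  by_cases hb : (2 : ℤ) ∣ b
  · -- `b` even, `a` odd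
    exact exists_normalised_freyCurve_of_odd hab h0 (fun ha ↦ hnot ⟨ha, hb⟩) hb p
  · by_cases ha : (2 : ℤ) ∣ a
    · -- `a` even, `b` odd: pass to `E_(b,a)` (the `−1` twist)
      have h0' : b * a * (b + a) ≠ 0 := by
        have : b * a * (b + a) = a * b * (a + b) := by ring
        rwa [this]
      obtain ⟨A, B, h1, h2, h3, h4, h5⟩ := exists_normalised_freyCurve_of_odd hab.symm h0' hb ha p
      exact ⟨A, B, h1, h2, h3, h4, (hasIrreducibleModPGaloisRep_freyCurve_swap_iff a b p).symm.trans h5⟩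
    · -- `a`, `b` odd, `a + b` even: pass to `E_(−a, a+b)` (translation)
      have hab2 : (2 : ℤ) ∣ a + b := by omega
      have h0' : (-a) * (a + b) * (-a + (a + b)) ≠ 0 := by
        have : (-a) * (a + b) * (-a + (a + b)) = -(a * b * (a + b)) := by ring
        rw [this]; exact neg_ne_zero.mpr h0
      have hcop : IsCoprime (-a) (a + b) := by
        have h := (hab.add_mul_left_right 1).neg_left
        rwa [mul_one, add_comm] at h
      obtain ⟨A, B, h1, h2, h3, h4, h5⟩ :=
        exists_normalised_freyCurve_of_odd hcop h0' (fun h ↦ ha ((dvd_neg).mp h)) hab2 p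
      exact ⟨A, B, h1, h2, h3, h4,
        (hasIrreducibleModPGaloisRep_freyCurve_translate_iff a b p).symm.trans h5⟩

/-! ### The exceptional curve `2A + B = 0` -/

/-- If `A, B` are coprime with `2A + B = 0` then `3 ∤ AB(A+B)` (indeed `A = ±1`, `B = ∓2`,
`AB(A+B) = 2A³ = ±2`): the curve is `y² = x³ − x` up to sign. [folklore] -/
theorem not_three_dvd_of_two_mul_add_eq_zero {A B : ℤ} (hAB : IsCoprime A B) (h : 2 * A + B = 0) :
    ¬ (3 : ℤ) ∣ A * B * (A + B) := by
  have hB : B = -2 * A := by linarith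
  have hunit : IsUnit A := hAB.isUnit_of_dvd' (dvd_refl A) ⟨-2, by rw [hB]; ring⟩
  rcases Int.isUnit_iff.mp hunit with rfl | rfl <;> subst hB <;> decide

/-! ### The glue stub -/

/-- **Registered stub `stub_freyFiveIrreducibleGlue` of the line `Sketch` (reshape 3): Frey rigidity
at `5`.**  Granted the statements of the sibling stubs S5 (`stub_freySemistableDichotomy`, Serre's
dichotomy on the `16 ∣ B` Frey curves), S6 (`stub_freySwanOdd`, odd Swan conductor of `E[5]` above
`2` on the additive normalised Frey curves with `2A + B ≠ 0`) and S7 (`stub_swanEvenOfStableLine`, a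
stable line makes it even), `E_(a,b)[5]` has no `Γ_ℚ`-stable subgroup other than `0` and `E[5]`
for all coprime `a, b` with `ab(a+b) ≠ 0`.  Proof: normalise (`exists_normalised_freyCurve`); if
`16 ∣ B`, S5 and Kubert (`stub_glue_dichotomy`, using that the `2`-torsion of a Frey curve is
rational, `smul_eq_of_two_nsmul_eq_zero_freyCurve`); if `16 ∤ B` and `2A + B ≠ 0`, S6 against S7
(`2n ∉ {1, 3}`); if `2A + B = 0`, `3 ∤ AB(A+B)` and `stub_glue_notThreeDvd`.
[cite: DiamondKramer1995, Lemmas 1–3] [cite: Kubert1976, Ch. IV (X₁(2,10))] -/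
theorem stub_freyFiveIrreducibleGlue :
    (∀ (A B : ℤ) [(freyCurve A B).IsElliptic], IsCoprime A B → A * B * (A + B) ≠ 0 →
      A ≡ -1 [ZMOD 4] → (16 : ℤ) ∣ B →
      ∀ H : AddSubgroup (geomTorsion (freyCurve A B) (5 : ℕ)),
        (∀ σ : Field.absoluteGaloisGroup ℚ, ∀ P ∈ H, σ • P ∈ H) → H ≠ ⊥ → H ≠ ⊤ →
        (∀ σ : Field.absoluteGaloisGroup ℚ, ∀ P ∈ H, σ • P = P) ∨
          ∀ (σ : Field.absoluteGaloisGroup ℚ) (Q : geomTorsion (freyCurve A B) (5 : ℕ)),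
            σ • Q - Q ∈ H) →
    (∀ (A B : ℤ) [(freyCurve A B).IsElliptic], IsCoprime A B → A * B * (A + B) ≠ 0 →
      A ≡ -1 [ZMOD 4] → (2 : ℤ) ∣ B → ¬ (16 : ℤ) ∣ B → 2 * A + B ≠ 0 →
      ∃ (v : HeightOneSpectrum (𝓞 ℚ)) (𝔓 : Ideal (absIntegers (𝓞 ℚ) ℚ)),
        (2 : 𝓞 ℚ) ∈ v.asIdeal ∧ 𝔓 ∈ v.primesAbove ∧
        (((freyCurve A B).torsionGaloisRep 5).swanConductorAt (𝓞 ℚ) 𝔓 = 1 ∨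
          ((freyCurve A B).torsionGaloisRep 5).swanConductorAt (𝓞 ℚ) 𝔓 = 3)) →
    (∀ (W : WeierstrassCurve ℚ) [W.IsElliptic] (H : AddSubgroup (geomTorsion W (5 : ℕ))),
      (∀ σ : Field.absoluteGaloisGroup ℚ, ∀ P ∈ H, σ • P ∈ H) → H ≠ ⊥ → H ≠ ⊤ →
      ∀ (v : HeightOneSpectrum (𝓞 ℚ)), (2 : 𝓞 ℚ) ∈ v.asIdeal →
      ∀ 𝔓 ∈ v.primesAbove, ∃ n : ℕ, (W.torsionGaloisRep 5).swanConductorAt (𝓞 ℚ) 𝔓 = 2 * n) →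
    ∀ a b : ℤ, IsCoprime a b → a * b * (a + b) ≠ 0 →
      (freyCurve a b).HasIrreducibleModPGaloisRep 5 := by
  intro hS5 hS6 hS7 a b hab h0
  -- normalise
  obtain ⟨A, B, hAB, h0', hA, hB, hiff⟩ := exists_normalised_freyCurve hab h0 5
  rw [hiff]
  haveI := isElliptic_freyCurve h0'
  -- the exceptional curve `2A + B = 0`
  by_cases hex : 2 * A + B = 0
  · exact stub_glue_notThreeDvd A B hAB h0' (not_three_dvd_of_two_mul_add_eq_zero hAB hex)
  intro H hst
  by_contra hH
  push Not at hH
  obtain ⟨hbot, htop⟩ := hH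
  by_cases h16 : (16 : ℤ) ∣ B
  · -- semistable branch: Serre's dichotomy against Kubert
    have hdich := hS5 A B hAB h0' hA h16 H hst hbot htop
    exact stub_glue_dichotomy (freyCurve A B)
      (fun σ _ hT ↦ smul_eq_of_two_nsmul_eq_zero_freyCurve h0' σ hT) H hst hbot htop hdich
  · -- additive branches: odd Swan conductor against the parity lemma
    obtain ⟨v, 𝔓, hv2, h𝔓, hodd⟩ := hS6 A B hAB h0' hA hB h16 hex
    obtain ⟨n, hn⟩ := hS7 (freyCurve A B) H hst hbot htop v hv2 𝔓 h𝔓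
    rw [hn] at hodd
    rcases hodd with h | h
    · have h' : (2 * n : ℕ) = 1 := by exact_mod_cast h
      omega
    · have h' : (2 * n : ℕ) = 3 := by exact_mod_cast h
      omega

end Summit.ABC.ABC.Theorems

end
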